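import Mathlib.Combinatorics.SimpleGraph.Sum
import Mathlib.Data.Finset.Sum
import Mathlib.Logic.Equiv.Fin.Basic
import Mathlib.Combinatorics.SimpleGraph.Coloring.Vertex
import Mathlib.Combinatorics.Pigeonhole
import Literature.ModelTheory.FiniteModelTheory.CohomologicalConsistencyThreeColouringProofs
import HarnessLib

/-!
# Transfer of sparsity along isomorphisms and disjoint unions; `K_{d,d}` on `Fin (2d)`

Topic `Literature/Combinatorics/SimpleGraph`.  Elementary plumbing for assembling the fooling
graphs of Conneryd–Ghannane–Pang 2025, Theorem 6.1, out of two lifts (`GraphLifts.lean`): the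
graph on `Fin n` is `(L₁ ⊕g L₂).comap e` for a bijection `e`, and we need to move
`IsSparse` (Def. 6.3), degrees and (non-)colourability across `⊕g` and the isomorphism.

* `card_edgesIn_iso`, `IsSparse.of_iso` — sparsity is invariant under isomorphism;
* `card_edgesIn_sum_le`, `IsSparse.sum` — a disjoint union of `(s, ε)`-sparse graphs is
  `(s, ε)`-sparse (traces `Finset.toLeft` / `Finset.toRight` from Mathlib);
* `exists_independent_of_colorable` — an `m`-colourable graph on `> m(t-1)` vertices has an
  independent `t`-set (pigeonhole);
* `completeBipartiteFin d` — Mathlib's `completeBipartiteGraph (Fin d) (Fin d)` (`K_{d,d}`)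
  transported to `Fin (2d)` along `finSumFinEquiv`; a simple `d`-regular graph on `2d` vertices
  for every `d` (`degree_completeBipartiteGraph_inl/inr`, `degree_completeBipartiteFin`), our
  second base graph.

## References

* [folklore].
* [ConnerydGhannanePang2025] arXiv:2511.17272, §6 (where the assembled graphs are used).
-/

namespace Literature.Combinatorics.SimpleGraph

open Finset
open Literature.ModelTheory.FiniteModelTheory.ConnerydGhannanePang (edgesIn mem_edgesIn IsSparse)

/-! ### Isomorphisms -/

section Iso

variable {V V' : Type*} [Fintype V] [DecidableEq V] [Fintype V'] [DecidableEq V']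
  {G : _root_.SimpleGraph V} {G' : _root_.SimpleGraph V'} [DecidableRel G.Adj] [DecidableRel G'.Adj]

/-- Edges inside `U` correspond to edges inside `φ(U)`. [folklore] -/
theorem card_edgesIn_iso (φ : G ≃g G') (U : Finset V) :
    (edgesIn G U).card = (edgesIn G' (U.map φ.toEquiv.toEmbedding)).card := by
  refine Finset.card_bij (fun e _ => Sym2.map φ e) (fun e he => ?_) (fun e _ e' _ h => ?_) fun e' he' => ?_
  · rw [mem_edgesIn] at he ⊢
    refine ⟨(SimpleGraph.Iso.map_mem_edgeSet_iff φ).2 he.1, fun y hy => ?_⟩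
    obtain ⟨x, hx, rfl⟩ := Sym2.mem_map.1 hy
    exact Finset.mem_map.2 ⟨x, he.2 x hx, rfl⟩
  · exact Sym2.map.injective φ.toEquiv.injective h
  · refine ⟨Sym2.map φ.symm e', ?_, ?_⟩
    · rw [mem_edgesIn] at he' ⊢
      refine ⟨(SimpleGraph.Iso.map_mem_edgeSet_iff φ.symm).2 he'.1, fun x hx => ?_⟩
      obtain ⟨y, hy, rfl⟩ := Sym2.mem_map.1 hx
      obtain ⟨u, hu, huy⟩ := Finset.mem_map.1 (he'.2 y hy)
      have : φ.symm y = u := by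
        rw [← huy]; exact φ.toEquiv.symm_apply_apply u
      rw [this]; exact hu
    · induction e' using Sym2.ind with
      | h x y => simp

/-- **Sparsity is invariant under isomorphism.** [folklore] -/
theorem IsSparse.of_iso (φ : G ≃g G') {s : ℕ} {ε : ℝ} (h : IsSparse G' s ε) : IsSparse G s ε := by
  intro U hU
  rw [card_edgesIn_iso φ U]
  have := h (U.map φ.toEquiv.toEmbedding) (by rw [Finset.card_map]; exact hU)
  rwa [Finset.card_map] at this

end Iso

/-! ### Disjoint unions -/

section Sum

variable {V₁ V₂ : Type*} [Fintype V₁] [DecidableEq V₁] [Fintype V₂] [DecidableEq V₂]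
  {G₁ : _root_.SimpleGraph V₁} {G₂ : _root_.SimpleGraph V₂} [DecidableRel G₁.Adj] [DecidableRel G₂.Adj]

/-- Decidability of adjacency in a disjoint union. [folklore] -/
instance instDecidableRelSumAdj : DecidableRel (G₁ ⊕g G₂).Adj := fun x y => by
  cases x <;> cases y <;> simp only [SimpleGraph.sum_adj] <;> infer_instance

/-- Edges inside `U` in a disjoint union come from edges inside the two traces. [folklore] -/
theorem card_edgesIn_sum_le (U : Finset (V₁ ⊕ V₂)) :
    (edgesIn (G₁ ⊕g G₂) U).card ≤ (edgesIn G₁ U.toLeft).card + (edgesIn G₂ U.toRight).card := by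
  classical
  have hsub : edgesIn (G₁ ⊕g G₂) U ⊆
      (edgesIn G₁ U.toLeft).map ⟨Sym2.map Sum.inl, Sym2.map.injective Sum.inl_injective⟩ ∪
        (edgesIn G₂ U.toRight).map ⟨Sym2.map Sum.inr, Sym2.map.injective Sum.inr_injective⟩ := by
    intro e he
    rw [mem_edgesIn] at he
    obtain ⟨hedge, hU⟩ := he
    revert hedge hU
    induction e using Sym2.ind with
    | h x y =>
      intro hedge hU
      rw [_root_.SimpleGraph.mem_edgeSet] at hedge
      rw [Finset.mem_union, Finset.mem_map, Finset.mem_map]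
      cases x with
      | inl a =>
        cases y with
        | inl b =>
          left
          refine ⟨s(a, b), (mem_edgesIn G₁).2 ⟨?_, fun z hz => ?_⟩, rfl⟩
          · rw [_root_.SimpleGraph.mem_edgeSet]; exact (SimpleGraph.sum_adj_inl).1 hedge
          · rw [Finset.mem_toLeft]
            refine hU _ ?_
            rcases Sym2.mem_iff.1 hz with rfl | rfl
            · exact Sym2.mem_mk_left _ _
            · exact Sym2.mem_mk_right _ _
        | inr b => exact absurd hedge (SimpleGraph.not_adj_sum_inl_inr a b)
      | inr a =>
        cases y with
        | inl b => exact absurd hedge fun h => SimpleGraph.not_adj_sum_inl_inr b a h.symm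
        | inr b =>
          right
          refine ⟨s(a, b), (mem_edgesIn G₂).2 ⟨?_, fun z hz => ?_⟩, rfl⟩
          · rw [_root_.SimpleGraph.mem_edgeSet]; exact (SimpleGraph.sum_adj_inr).1 hedge
          · rw [Finset.mem_toRight]
            refine hU _ ?_
            rcases Sym2.mem_iff.1 hz with rfl | rfl
            · exact Sym2.mem_mk_left _ _
            · exact Sym2.mem_mk_right _ _
  calc (edgesIn (G₁ ⊕g G₂) U).card ≤ _ := Finset.card_le_card hsub
    _ ≤ _ := Finset.card_union_le _ _
    _ = (edgesIn G₁ U.toLeft).card + (edgesIn G₂ U.toRight).card := by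
        rw [Finset.card_map, Finset.card_map]

/-- **A disjoint union of `(s, ε)`-sparse graphs is `(s, ε)`-sparse.** [folklore] -/
theorem IsSparse.sum {s : ℕ} {ε : ℝ} (h₁ : IsSparse G₁ s ε) (h₂ : IsSparse G₂ s ε) :
    IsSparse (G₁ ⊕g G₂) s ε := by
  intro U hU
  have hp : U.toLeft.card + U.toRight.card = U.card := Finset.card_toLeft_add_card_toRight
  have hl : U.toLeft.card ≤ s := by omega
  have hr : U.toRight.card ≤ s := by omega
  have e1 : ((edgesIn G₁ U.toLeft).card : ℝ) ≤ (1 + ε) * U.toLeft.card := h₁ U.toLeft hl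
  have e2 : ((edgesIn G₂ U.toRight).card : ℝ) ≤ (1 + ε) * U.toRight.card := h₂ U.toRight hr
  have hp' : ((U.toLeft.card + U.toRight.card : ℕ) : ℝ) = U.card := by exact_mod_cast hp
  push_cast at hp'
  calc ((edgesIn (G₁ ⊕g G₂) U).card : ℝ)
      ≤ (((edgesIn G₁ U.toLeft).card + (edgesIn G₂ U.toRight).card : ℕ) : ℝ) := by
        exact_mod_cast card_edgesIn_sum_le U
    _ ≤ (1 + ε) * U.toLeft.card + (1 + ε) * U.toRight.card := by push_cast; linarith
    _ = (1 + ε) * (U.toLeft.card + U.toRight.card) := by ring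
    _ = (1 + ε) * U.card := by rw [hp']

end Sum

/-! ### Independent sets from colourings -/

/-- **Pigeonhole**: an `m`-colourable graph on more than `m(t-1)` vertices has an independent
`t`-set (a large colour class). [folklore] -/
theorem exists_independent_of_colorable {V : Type*} [Fintype V] [DecidableEq V]
    {G : _root_.SimpleGraph V} {m t : ℕ} (h : G.Colorable m) (ht : m * (t - 1) < Fintype.card V) :
    ∃ T : Finset V, T.card = t ∧ ∀ u ∈ T, ∀ v ∈ T, ¬ G.Adj u v := by
  classical
  obtain ⟨C⟩ := h
  obtain ⟨y, hy⟩ := Fintype.exists_lt_card_fiber_of_mul_lt_card (f := C) (n := t - 1)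
    (by rw [Fintype.card_fin]; exact ht)
  obtain ⟨T, hTsub, hTcard⟩ := Finset.exists_subset_card_eq (s := Finset.univ.filter fun x => C x = y)
    (n := t) (by omega)
  refine ⟨T, hTcard, fun u hu v hv huv => ?_⟩
  have hu' := (Finset.mem_filter.1 (hTsub hu)).2
  have hv' := (Finset.mem_filter.1 (hTsub hv)).2
  exact C.valid huv (hu'.trans hv'.symm)

/-! ### `K_{d,d}` on `Fin (2d)` -/

section CompleteBipartite

variable {V₁ V₂ : Type*} [Fintype V₁] [Fintype V₂]

/-- Decidability of adjacency in Mathlib's complete bipartite graph. [folklore] -/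
instance instDecidableRelCompleteBipartiteAdj : DecidableRel (completeBipartiteGraph V₁ V₂).Adj :=
  fun v w => by rw [completeBipartiteGraph_adj]; infer_instance

/-- Left degrees of `completeBipartiteGraph V₁ V₂` are `|V₂|` (not in Mathlib). [folklore] -/
theorem degree_completeBipartiteGraph_inl (v : V₁) :
    (completeBipartiteGraph V₁ V₂).degree (Sum.inl v) = Fintype.card V₂ := by
  classical
  rw [← _root_.SimpleGraph.card_neighborFinset_eq_degree]
  have h : (completeBipartiteGraph V₁ V₂).neighborFinset (Sum.inl v) =
      (Finset.univ : Finset V₂).map ⟨Sum.inr, Sum.inr_injective⟩ := by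
    ext w
    rw [_root_.SimpleGraph.mem_neighborFinset, completeBipartiteGraph_adj, Finset.mem_map]
    cases w with
    | inl a => simp
    | inr b => simp
  rw [h, Finset.card_map, Finset.card_univ]

/-- Right degrees of `completeBipartiteGraph V₁ V₂` are `|V₁|` (not in Mathlib). [folklore] -/
theorem degree_completeBipartiteGraph_inr (w : V₂) :
    (completeBipartiteGraph V₁ V₂).degree (Sum.inr w) = Fintype.card V₁ := by
  classical
  rw [← _root_.SimpleGraph.card_neighborFinset_eq_degree]
  have h : (completeBipartiteGraph V₁ V₂).neighborFinset (Sum.inr w) =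
      (Finset.univ : Finset V₁).map ⟨Sum.inl, Sum.inl_injective⟩ := by
    ext v
    rw [_root_.SimpleGraph.mem_neighborFinset, completeBipartiteGraph_adj, Finset.mem_map]
    cases v with
    | inl a => simp
    | inr b => simp
  rw [h, Finset.card_map, Finset.card_univ]

end CompleteBipartite

/-- The identification `Fin (2d) ≃ Fin d ⊕ Fin d` (cast to `Fin (d + d)`, then `finSumFinEquiv`).
[folklore] -/
def finTwoMulEquivSum (d : ℕ) : Fin (2 * d) ≃ Fin d ⊕ Fin d :=
  (finCongr (two_mul d)).trans finSumFinEquiv.symm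

/-- **`K_{d,d}` ON `Fin (2d)`**: Mathlib's `completeBipartiteGraph (Fin d) (Fin d)` transported
along `finTwoMulEquivSum d` — a simple `d`-regular graph on `2d` vertices for every `d`, used as
a base graph for lifts (a `d`-regular simple graph whose order `2d` satisfies
`gcd(d+1, 2d) ∣ 2`). [folklore] -/
def completeBipartiteFin (d : ℕ) : _root_.SimpleGraph (Fin (2 * d)) :=
  (completeBipartiteGraph (Fin d) (Fin d)).comap (finTwoMulEquivSum d)

/-- Decidability of adjacency in `completeBipartiteFin d`. [folklore] -/
instance completeBipartiteFin.instDecidableRel (d : ℕ) : DecidableRel (completeBipartiteFin d).Adj :=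
  fun i j => by unfold completeBipartiteFin; rw [_root_.SimpleGraph.comap_adj]; infer_instance

/-- `completeBipartiteFin d` is isomorphic to `completeBipartiteGraph (Fin d) (Fin d)`. [folklore] -/
def completeBipartiteFinIso (d : ℕ) : completeBipartiteFin d ≃g completeBipartiteGraph (Fin d) (Fin d) :=
  _root_.SimpleGraph.Iso.comap (finTwoMulEquivSum d) _

/-- **`completeBipartiteFin d` is `d`-regular.** [folklore] -/
theorem degree_completeBipartiteFin (d : ℕ) (i : Fin (2 * d)) : (completeBipartiteFin d).degree i = d := by
  classical
  rw [← (completeBipartiteFinIso d).degree_eq i]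
  change (completeBipartiteGraph (Fin d) (Fin d)).degree (finTwoMulEquivSum d i) = d
  rcases finTwoMulEquivSum d i with a | b
  · rw [degree_completeBipartiteGraph_inl, Fintype.card_fin]
  · rw [degree_completeBipartiteGraph_inr, Fintype.card_fin]

/-- `completeBipartiteFin d` is `d`-regular. [folklore] -/
theorem isRegularOfDegree_completeBipartiteFin (d : ℕ) : (completeBipartiteFin d).IsRegularOfDegree d :=
  fun i => degree_completeBipartiteFin d i

end Literature.Combinatorics.SimpleGraph
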